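import Literature.NumberTheory.EllipticCurves.HeegnerPointsKolyvaginPrimaryUnramifiedProofs
import Literature.NumberTheory.EllipticCurves.SerreOpenImageReductionInertiaProofs
import Literature.NumberTheory.EllipticCurves.TateModuleWildKernelProofs
import Literature.NumberTheory.EllipticCurves.NeronOggShafarevichLocal
import Literature.NumberTheory.GaloisRepresentations.IntegralGaloisActionProofs
import HarnessLib

/-!
# Route `CMKolyvaginAtInertTwo`, crux `CMKolyvaginExactAtInertTwo` (stmt-BirchSwinnertonDyer-24277) —
# GENUS TRIVIALITY OF DEEP KOLYVAGIN CLASSES AT THE PRIMES OF `d_K`, CORE: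
# McCallum's class over `ℚ` is SELMER at a ramified prime `q` as soon as the point is invariant one
# level deeper and the inertia at `q` acts through an involution

Seat `bsd-line-cmk2-p1` g20 (cell `bsd-print-cf2`), `--supports stmt-BirchSwinnertonDyer-24277` (helper;
closes nothing).  THEOREMS ONLY (no definition, no named fact, no `sorry`).  BSD is NOT proved by any
of this; the crux is not closed here.

WHY (the composite-`d_K` residual of 24277, KERNEL-STATUS §18.4 (i) / `MEMO-composite-dK-gap.md`).
Both halves of the crux are tree theorems on `Σ ≤ 1` (g18 upper, g19 lower) modulo prints; for
`Σ ≥ 3` the ℚ-pair method loses `2^{Σ−1}` on each side, and on the LOWER side gk2-p4's defect-rank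
frame (`…RTLadderFrameOneSided.two_mul_le_padicValNat_add_of_ladders_of_sha_le`) says exactly what
is missing: the GENUS DEFECTS of the descended Kolyvagin classes, i.e. their failure to be locally
trivial over `ℚ_q` at the primes `q ∣ d_K` (they are locally trivial over `K_𝔮` by Gross 6.2 (1)).
THIS FILE proves that the defect VANISHES for the `W`-side (sign `+1`, even depth on H₂) classes,
by an explicit computation with McCallum's cocycle: at an inertia element `g` at `q`
(good reduction, `q` odd), the value `gQ − Q − (gP − P)/n` is an `n`-torsion point whose reduction
is `−red((gP − P)/n)`; if `P` is invariant modulo `2n·A` and `g²` fixes `A` (ramification index `2`),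
then `R' = (gP − P)/2n` satisfies `gR' = −R'`, so `red R'` is `2`-torsion and `red((gP−P)/n) =
2·red R' = 0`; injectivity of reduction on prime-to-`q` torsion gives the vanishing of the cocycle
on inertia, and Milne *ADT* I.3.8 (tree `Milne2006_unramifiedClass_eq_zero_holds`) the local
condition.  No hypothesis on the depth beyond ONE extra level, none on `#Ẽ(𝔽_q)`.

* §1 `coe_cocycle_apply_eq_zero_of_reduction` — the algebraic core (any `G`-module
  `M`, any additive `ρ : M → M̄` invariant under `g` and injective on `M[n]`).
* §2 `cls_mem_resKer_of_cocycle_vanishing` — local condition from the vanishing of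
  McCallum's `M[n]`-valued cocycle on an inertia set (sibling of the tree's
  `cls_mem_resKer_of_vanishing`, which needs the `M`-valued cocycle `−(gP−P)/n` to vanish — false here).
* §3 `exists_geomReduction_conj_of_mem_inertia` — over `ℚ`: for every prime `𝔓` of `\bar ℤ` above a
  good prime `q` and `g ∈ I_𝔓`, a reduction homomorphism `E(ℚ̄) → Ẽ(𝔽̄_q)` invariant under `g` and
  injective on prime-to-`q` torsion (the tree's `geomReduction` along `placeOver q`, conjugated by
  `exists_smul_eq_of_mem_primesAbove_holds`; Serre 1972 §1.11 `geomReduction_smul_of_mem_inertia`).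
* §4 **`kolyvaginClass_mem_selmerLocalKer_of_sq_of_deep`** — THE CRITERION: `W/ℚ` globally minimal,
  `q` an odd good prime, `u` its place, `A ≤ E(ℚ̄)` admissible for `n` with `[2]` injective on `A`,
  `P ∈ A` invariant modulo `2n·A` under `Γ_ℚ`, and every inertia element above `q` acting on `A`
  through an involution (`g•g•a = a`): then Kolyvagin's class `c_n(P) ∈ H¹(ℚ, E[n])` satisfies the
  Selmer local condition at `u`.

Consumers (next files of this seat / gk2): `A = E(K[m])` embedded in `E(ℚ̄)` (`K[m]/ℚ` has
ramification index `2` at `q ∣ d_K`, `q ∤ m`), `P = P(m)` a derived Heegner point of EVEN depth on H₂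
(`τ P(m) ≡ +P(m)`), level `n = 2^{M}` with `M + 1 ≤ M(m)`: the `W`-side ladder classes lie in
`Ш(W/ℚ)` itself, so the defect-rank frame runs with `β₊ = 0` and gives the lower half of 24277 for
every odd `d_K` (memo `Cruxes/CMExactDescentAtTwo/MEMO-genus-triviality.md`).

References: [McCallumLMS1991] §4 Lemma 4.1, Cor. 4.2, Lemma 4.3; [GrossLMS1991] §4 (4.6), Prop. 6.2 (1);
[MilneADT2006] Ch. I Prop. 3.8; [Serre1972] §1.11; [SilvermanAEC2009] VII.3.1(b), VIII.§1.
-/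

set_option autoImplicit false
-- the Theorems namespace of this sub repeats the summit name by design (D-0017 nested layout)
set_option linter.dupNamespace false

noncomputable section

open scoped Classical Pointwise AddSubgroup

universe u

/-! ## §1 The algebraic core and §2 the cocycle-vanishing criterion (abstract `G`-modules) -/

namespace Summit.BirchSwinnertonDyer.BirchSwinnertonDyer.Theorems.KolyvaginGenusTwo

open Literature.NumberTheory.GaloisRepresentations Literature.NumberTheory.EllipticCurves
open Literature.NumberTheory.EllipticCurves.KolyvaginCocycle

section Core

variable {G : Type u} [Group G] [TopologicalSpace G] [IsTopologicalGroup G]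
variable {M : Type u} [AddCommGroup M] [DistribMulAction G M] [TopologicalSpace M]
  [DiscreteTopology M]
variable {A : AddSubgroup M} {n : ℤ}

omit [IsTopologicalGroup G] in
/-- **The algebraic core of genus triviality.**  McCallum's cocycle value
`u = gQ − Q − (gP − P)/n ∈ M[n]` VANISHES at `g` as soon as: some additive `ρ : M → M̄` is
`g`-invariant (`ρ (g•x) = ρ x`, printed: `g` is an inertia element and `ρ` the reduction map) and
injective on `M[n]` (`E[n] ↪ Ẽ` for `q ∤ n`), `[2n]` is injective on `A`, `g` acts on `P` through an
involution (`g•g•P = P`), and `P` is invariant one level deeper (`gP − P ∈ 2n·A`).  Proof: with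
`gP − P = 2n·R'`, `g(gP − P) = −(gP − P)` forces `gR' = −R'`, so `ρ R' = ρ(gR') = −ρ R'` is
`2`-torsion; the root `(gP−P)/n = 2R'` has `ρ`-image `0`; `ρ u = −ρ(2R') = 0` and `n u = 0` give
`u = 0`. [cite: McCallumLMS1991, §4 Lemma 4.1] [cite: SilvermanAEC2009, VII.3.1(b), VIII.§1] -/
theorem coe_cocycle_apply_eq_zero_of_reduction (hA : IsAdmissible G A n)
    (hcont : ∀ m : M, Continuous fun g : G ↦ g • m) {P : M} (hP : P ∈ invPoints G A n) {Q : M}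
    (hQ : n • Q = P) {Mbar : Type*} [AddCommGroup Mbar] (ρ : M →+ Mbar) (g : G)
    (hρg : ∀ x : M, ρ (g • x) = ρ x) (hρinj : ∀ t : M, n • t = 0 → ρ t = 0 → t = 0)
    (hA2 : ∀ ⦃a : M⦄, a ∈ A → (2 * n) • a = 0 → a = 0) (hg2 : g • g • P = P)
    (hdeep : ∃ R' ∈ A, (2 * n) • R' = g • P - P) :
    ((cocycle hA hcont hP hQ).1 g : M) = 0 := by
  obtain ⟨R', hR', hR'e⟩ := hdeep
  -- the root at level `n` is `2 • R'`
  have hroot : rootIn A n (g • P - P) = (2 : ℤ) • R' :=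
    rootIn_eq hA.eq_zero_of_zsmul (A.zsmul_mem hR' 2) (by rw [smul_smul, mul_comm, hR'e])
  -- `g • R' = -R'`
  have hgR : g • R' = -R' := by
    have h1 : (2 * n) • (g • R') = -((2 * n) • R') := by
      rw [← smul_zsmul_comm, hR'e, smul_sub, hg2, neg_sub]
    have h2 : (2 * n) • (g • R' + R') = 0 := by rw [zsmul_add, h1, neg_add_cancel]
    exact eq_neg_of_add_eq_zero_left (hA2 (A.add_mem (hA.smul_mem g hR') hR') h2)
  -- `ρ R'` is `2`-torsion
  have hρR : (2 : ℤ) • ρ R' = 0 := by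
    have h := hρg R'
    rw [hgR, map_neg] at h
    rw [two_zsmul]
    exact neg_eq_iff_add_eq_zero.mp h
  -- the value `u` is `n`-torsion with `ρ u = 0`
  have hval := coe_cocycle_apply hA hcont hP hQ g
  have htors : n • ((cocycle hA hcont hP hQ).1 g : M) = 0 :=
    (mem_torsionBy_iff' n _).mp ((cocycle hA hcont hP hQ).1 g).2
  refine hρinj _ htors ?_
  rw [hval, map_sub, map_sub, hρg, sub_self, zero_sub, hroot, map_zsmul, hρR, neg_zero]

variable {H : Type u} [Group H] [TopologicalSpace H] [IsTopologicalGroup H]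
variable {M' : Type u} [AddCommGroup M'] [DistribMulAction H M'] [TopologicalSpace M']
  [DiscreteTopology M']

/-- **Vanishing of McCallum's `M[n]`-valued cocycle on inertia ⇒ local condition.**  Along a
compatible pair `(θ : H → G, Ψ : M → M')` (printed: restriction to a decomposition group and
`E(K̄) → E(K̄_v)`): if the cocycle `g ↦ gQ − Q − (gP−P)/n` vanishes on `θ(I)` for a set `I ⊆ H` and
classes of `M'`-valued cocycles vanishing on `I` are trivial (Milne *ADT* I.3.8 at good reduction),
then `c(P; Q)` lies in the kernel of `H¹(G, M[n]) → H¹(H, M')`.  Sibling of the tree's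
`cls_mem_resKer_of_vanishing` (which uses the cohomologous `M`-valued cocycle `−(gP−P)/n`).
[cite: GrossLMS1991, Prop. 6.2 (1)] [cite: MilneADT2006, Ch. I Prop. 3.8] -/
theorem cls_mem_resKer_of_cocycle_vanishing (θ : H →ₜ* G) (Ψ : M →+ M')
    (hA : IsAdmissible G A n) (hcont : ∀ m : M, Continuous fun g : G ↦ g • m)
    {P : M} (hP : P ∈ invPoints G A n) {Q : M} (hQ : n • Q = P)
    (hc : ∀ (h : H) (x : M[n]),
      (Ψ.comp (M[n]).subtype) (θ h • x) = h • (Ψ.comp (M[n]).subtype) x)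
    {I : Set H} (hI : ∀ σ ∈ I, ((cocycle hA hcont hP hQ).1 (θ σ) : M) = 0)
    (hvanish : ∀ f : contOneCocycles (discreteTopRep H M'), (∀ σ ∈ I, f.1 σ = 0) →
      oneCocycleClass _ f = 0) :
    cls hA hcont hP hQ ∈ resKer θ (Ψ.comp (M[n]).subtype) hc := by
  unfold cls
  rw [mem_resKer_iff, map_oneCocycleClass]
  refine hvanish _ fun σ hσ ↦ ?_
  change Ψ (((cocycle hA hcont hP hQ).1 (θ σ) : M[n]) : M) = 0
  rw [hI σ hσ, map_zero]

end Core

/-! ## §3 Over `ℚ`: a reduction map invariant under a given inertia element -/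

section Rat

open WeierstrassCurve NumberField IsDedekindDomain Field Rat.HeightOneSpectrum

/-- **A `g`-invariant reduction map for every inertia element above a good prime.**  `W/ℚ`
globally minimal elliptic, `q ∤ Δ_W` prime, `v` the place of `ℚ` at `q`, `𝔓` ANY prime of `\bar ℤ`
above `v`, `g ∈ I_𝔓`.  Then there is an additive `ρ : E(ℚ̄) → Ẽ(𝔽̄_q)` with `ρ (g • x) = ρ x` and
`ρ` injective on the `m`-torsion for every `q ∤ m` — namely `red ∘ γ⁻¹` for the tree's reduction
`red = geomReduction` along `placeOver q` (prime `𝔓₀`) and `γ` with `γ • 𝔓₀ = 𝔓`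
(`exists_smul_eq_of_mem_primesAbove_holds`), using `I_{γ•𝔓₀} = γ I_{𝔓₀} γ⁻¹` and Serre's
"inertia acts trivially on `Ẽ`" (`geomReduction_smul_of_mem_inertia`).
[cite: Serre1972, §1.11, Prop. 11 (proof)] [cite: SilvermanAEC2009, VII.3.1(b)] -/
theorem exists_geomReduction_conj_of_mem_inertia (W : WeierstrassCurve ℚ) [W.IsGloballyMinimal]
    [W.IsElliptic] {q : ℕ} [Fact q.Prime] (hΔ : ¬ (q : ℤ) ∣ minimalDiscriminantInt W)
    {v : HeightOneSpectrum (𝓞 ℚ)} (hv : (primesEquiv v : ℕ) = q)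
    {𝔓 : Ideal (absIntegers (𝓞 ℚ) ℚ)} (h𝔓 : 𝔓 ∈ v.primesAbove)
    {g : absoluteGaloisGroup ℚ} (hg : g ∈ 𝔓.inertia (absoluteGaloisGroup ℚ)) :
    ∃ ρ : W.geomPoints →+ (reductionModPrime W q).geomPoints,
      (∀ x, ρ (g • x) = ρ x) ∧
        ∀ m : ℕ, ¬ q ∣ m → ∀ t : W.geomPoints, m • t = 0 → ρ t = 0 → t = 0 := by
  obtain ⟨𝔓₀, hmem₀, h𝔓₀⟩ := exists_ideal_placeOver q hv
  obtain ⟨γ, hγ⟩ := HeightOneSpectrum.exists_smul_eq_of_mem_primesAbove_holds h𝔓₀ h𝔓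
  -- `γ⁻¹ g γ ∈ I_{𝔓₀}`
  have hg₀ : γ⁻¹ * g * γ ∈ 𝔓₀.inertia (absoluteGaloisGroup ℚ) := by
    rw [← hγ] at hg
    exact (mem_inertia_smul_iff_conj_mem γ g 𝔓₀).mp hg
  refine ⟨(geomReduction hΔ).comp (DistribSMul.toAddMonoidHom W.geomPoints γ⁻¹),
    fun x ↦ ?_, fun m hm t ht hρ ↦ ?_⟩
  · change geomReduction hΔ (γ⁻¹ • g • x) = geomReduction hΔ (γ⁻¹ • x)
    have : γ⁻¹ • g • x = (γ⁻¹ * g * γ) • (γ⁻¹ • x) := by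
      rw [mul_smul, mul_smul, smul_inv_smul]
    rw [this, geomReduction_smul_of_mem_inertia hΔ hmem₀ hg₀]
  · change geomReduction hΔ (γ⁻¹ • t) = 0 at hρ
    have ht' : m • (γ⁻¹ • t) = 0 := by rw [smul_comm, ht, smul_zero]
    have h0 := eq_zero_of_smul_eq_zero_of_geomReduction_eq_zero (hΔ := hΔ) hm ht' hρ
    rwa [smul_eq_zero_iff_eq] at h0

/-! ## §4 The criterion: Kolyvagin's class over `ℚ` is Selmer at a ramified good prime -/

/-- **GENUS TRIVIALITY CRITERION.**  `W/ℚ` globally minimal elliptic; `q` an odd prime of good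
reduction (`q ∤ Δ_W`), `u` the place of `ℚ` at `q`; `A ≤ E(ℚ̄)` a `Γ_ℚ`-stable subgroup on which
`[2n]` (hence `[n]`) is injective; `P ∈ A` with `(g − 1)P ∈ n·A` for all `g ∈ Γ_ℚ` (so that
Kolyvagin's class `c_n(P) ∈ H¹(ℚ, E[n])` is defined) and, ONE LEVEL DEEPER, `(g − 1)P ∈ 2n·A` for all
`g`; `q ∤ n`; and every inertia element above `q` acts on `P` through an involution
(`g • g • P = P`, printed: the ramification index of `ℚ(A)/ℚ` at `q` divides `2`).  Then `c_n(P)`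
satisfies the Selmer local condition at `u`: its image in `H¹(ℚ_q, E)` vanishes.  (§1 at each local
inertia element — which restricts into the global inertia group of the prime cut out by the
embedding `ℚ̄ → ℚ̄_q`, Neukirch II (9.6) `resGalOfEmb_mem_inertia_primeBelow` — with the reduction
of §3; then §2 with Milne *ADT* I.3.8.)  For `A = E(K[m])`, `q ∣ d_K`, `q ∤ m`, `P = P(m)` of even
depth and `n = 2^M`, `M + 1 ≤ M(m)`, this is the vanishing of the genus defect at `q` of the
`W`-side descended Kolyvagin class. [cite: GrossLMS1991, §4 (4.6) and Prop. 6.2 (1)]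
[cite: McCallumLMS1991, §4 Lemma 4.1, Lemma 4.3] [cite: MilneADT2006, Ch. I Prop. 3.8] -/
theorem kolyvaginClass_mem_selmerLocalKer_of_sq_of_deep (W : WeierstrassCurve ℚ)
    [W.IsGloballyMinimal] [W.IsElliptic] {q : ℕ} [Fact q.Prime]
    (hΔ : ¬ (q : ℤ) ∣ minimalDiscriminantInt W) {u : HeightOneSpectrum (𝓞 ℚ)}
    (hu : (primesEquiv u : ℕ) = q) (hgood : W.HasGoodReductionAt u)
    {n : ℕ} (hqn : ¬ q ∣ n)
    {hdiv : ∀ P : geomPoints W, ∃ Q : geomPoints W, (n : ℤ) • Q = P}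
    {A : AddSubgroup (geomPoints W)} (hA : IsAdmissible (absoluteGaloisGroup ℚ) A (n : ℤ))
    (hA2 : ∀ ⦃a : geomPoints W⦄, a ∈ A → (2 * (n : ℤ)) • a = 0 → a = 0)
    {P : geomPoints W} (hP : P ∈ invPoints (absoluteGaloisGroup ℚ) A (n : ℤ))
    (hdeep : P ∈ invPoints (absoluteGaloisGroup ℚ) A (2 * (n : ℤ)))
    (hsq : ∀ 𝔓 ∈ u.primesAbove, ∀ g ∈ 𝔓.inertia (absoluteGaloisGroup ℚ), g • g • P = P) :
    kolyvaginClass W (n : ℤ) hdiv hA P hP ∈ selmerLocalKer W (u.adicCompletion ℚ) (n : ℤ) := by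
  -- a prime of the local absolute integers above `u`
  obtain ⟨𝔐, h𝔐⟩ := u.localPrimesAbove_nonempty
  have hQ := Classical.choose_spec (hdiv P)
  rw [kolyvaginClass_eq_cls hA hP hQ]
  refine cls_mem_resKer_of_cocycle_vanishing (resGal (K := ℚ) (u.adicCompletion ℚ))
    (pointsMap W (u.adicCompletion ℚ)) hA _ hP hQ _
    (I := (𝔐.inertia (absoluteGaloisGroup (u.adicCompletion ℚ)) : Set _)) (fun σ hσ ↦ ?_)
    (fun f hf ↦ Milne2006_unramifiedClass_eq_zero_holds W u hgood h𝔐 f hf)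
  -- the local inertia element restricts into the global inertia of the prime cut out by the embedding
  have h𝔓 := u.primeBelow_mem_primesAbove (ι := closureEmb (K := ℚ) (u.adicCompletion ℚ)) h𝔐
  have hg := u.resGalOfEmb_mem_inertia_primeBelow (closureEmb (K := ℚ) (u.adicCompletion ℚ)) 𝔐 hσ
  obtain ⟨ρ, hρg, hρinj⟩ := exists_geomReduction_conj_of_mem_inertia W hΔ hu h𝔓 hg
  refine coe_cocycle_apply_eq_zero_of_reduction hA _ hP hQ ρ _ hρg
    (fun t ht h0 ↦ hρinj n hqn t (by exact_mod_cast ht) h0) hA2 (hsq _ h𝔓 _ hg) ?_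
  exact hdeep.2 _

end Rat

end Summit.BirchSwinnertonDyer.BirchSwinnertonDyer.Theorems.KolyvaginGenusTwo

end
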